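import Summits.RiemannHypothesis.RiemannHypothesis.Theorems.WeilColumnThetaPrimeBounds
import Summits.RiemannHypothesis.RiemannHypothesis.Theorems.WeilColumnThetaPrimeTailCheb
import HarnessLib

/-!
# THETA kernel certificate: the PRIME SIDE in the interface's currency WITHOUT Rosser–Schoenfeld (RH-FREE, UNCONDITIONAL)

Cell `rh-explicit`, WEIL column, seat handoff-prove-2 gen12 (ATTEMPT-22 §5).  `norm_weilPrimeTerm_oddTail_le` (sibling file) with the
Chebyshev constant `C = log 4 + 2·log N/√N`, `N = e^{−2x₁} ≥ e²` (i.e. `x₁ ≤ −1`), and NO hypothesis on `ψ` (Mathlib `Chebyshev.psi_le`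
through `WeilColumnThetaPrimeTailCheb`).  Nothing here bears on the truth of RH.
-/

noncomputable section

set_option linter.dupNamespace false

open Complex Set MeasureTheory Filter
open scoped Real Topology ArithmeticFunction.vonMangoldt Chebyshev

namespace Summit.RiemannHypothesis.RiemannHypothesis.Theorems.WeilColumn.ThetaMellin

open Literature.NumberTheory.LFunctions

namespace ThetaParams

/-! ## The prime side with the Chebyshev constant -/

/-- **`primes`, UNCONDITIONAL**: as `norm_weilPrimeTerm_oddTail_le` with `C = log 4 + 2·log N/√N`, `N = e^{−2x₁} ≥ e²` (i.e. `x₁ ≤ −1`),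
and NO hypothesis on `ψ` (Mathlib `Chebyshev.psi_le`). [Chebyshev; THETA-CERT-cc6 §D6; ATTEMPT-22 §5] -/
theorem norm_weilPrimeTerm_oddTail_le_cheb {T g : ℝ → ℂ} {E x₁ a : ℝ} {m : ℕ} (hm : 2 ≤ m) (hx₁ : x₁ ≤ -1) (hE : 0 ≤ E)
    (hT0 : ∀ u, x₁ < u → T u = 0)
    (hTE : ∀ u, u ≤ x₁ → ‖T u‖ ≤ E * Real.exp (((m : ℝ) + 1 / 2) * (u - x₁)))
    (hgt : IsWeilTest g) (hsupp : tsupport g ⊆ Icc (-a) a) (hg : ∀ u, g u = T u - T (-u)) :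
    ‖weilPrimeTerm (weilConv g (weilReflect g))‖ ≤
      2 * E ^ 2 / ((m : ℝ) + 1 / 2) * vonMangoldtSum (m + 1) +
        2 * E ^ 2 * Real.sqrt (Real.exp (-2 * x₁)) *
          ((Real.log 4 + 2 * (Real.log (Real.exp (-2 * x₁)) / Real.sqrt (Real.exp (-2 * x₁)))) *
            (Real.exp (-((m : ℝ) / ((m : ℝ) + 1))) / ((m : ℝ) + 1) + 1 / (m : ℝ) ^ 2)) := by
  have hN2 : Real.exp 2 ≤ Real.exp (-2 * x₁) := Real.exp_le_exp.2 (by linarith)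
  have hN : 0 < Real.exp (-2 * x₁) := Real.exp_pos _
  have hx₁ : x₁ < 0 := by linarith
  have hS₂ := fun K ↦ ThetaPrime.vonMangoldt_logTail_sum_le_cheb (m := m) (by omega) hN2 K
  have h := ThetaPrime.norm_weilPrimeTerm_le_of_oddTail (by omega) hx₁ hE hT0 hTE hgt hsupp hg
    (fun K ↦ sum_vonMangoldt_div_pow_le hm K) hS₂
  refine h.trans (le_of_eq ?_)
  have hNm : Real.exp (-2 * x₁) ^ m ≠ 0 := pow_ne_zero _ hN.ne'
  set C := Real.log 4 + 2 * (Real.log (Real.exp (-2 * x₁)) / Real.sqrt (Real.exp (-2 * x₁))) with hC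
  have e : Real.exp (-2 * x₁) ^ m * Real.sqrt (Real.exp (-2 * x₁)) *
      (C * (Real.exp (-((m : ℝ) / ((m : ℝ) + 1))) / ((m : ℝ) + 1) + 1 / (m : ℝ) ^ 2) / Real.exp (-2 * x₁) ^ m) =
      Real.sqrt (Real.exp (-2 * x₁)) * (C * (Real.exp (-((m : ℝ) / ((m : ℝ) + 1))) / ((m : ℝ) + 1) + 1 / (m : ℝ) ^ 2)) := by
    rw [mul_div_assoc', mul_comm (Real.exp (-2 * x₁) ^ m) (Real.sqrt _), mul_assoc, mul_div_assoc,
      mul_div_cancel_left₀ _ hNm]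
  rw [mul_assoc (2 * E ^ 2) (Real.exp (-2 * x₁) ^ m * Real.sqrt (Real.exp (-2 * x₁))), e, ← mul_assoc]

end ThetaParams

end Summit.RiemannHypothesis.RiemannHypothesis.Theorems.WeilColumn.ThetaMellin

end
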